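import Mathlib.Analysis.Normed.Module.Connected
import Mathlib.Analysis.Convex.PathConnected
import Mathlib.LinearAlgebra.Dimension.Finrank
import Mathlib.LinearAlgebra.FiniteDimensional.Defs
import Mathlib.Topology.Connected.LocallyPathConnected
import Mathlib.Topology.OpenPartialHomeomorph.IsImage
import Mathlib.Topology.OpenPartialHomeomorph.Constructions
import Mathlib.Topology.IsLocalHomeomorph
import Literature.AlgebraicGeometry.HodgeTheory.ZariskiClosedStraighteningSmooth
import Literature.AlgebraicGeometry.HodgeTheory.LefschetzOneOneProofs
import HarnessLib

/-!
# Connected covers of a smooth complex variety stay connected over a dense Zariski open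

Topic `Literature/AlgebraicGeometry/FundamentalGroup`. For `X` an integral `ℂ`-scheme smooth of
relative dimension `n` over `ℂ`, `Z ⊊ X` Zariski-closed and `q : T → X(ℂ)` a local homeomorphism
(e.g. a covering map) from a CONNECTED, locally path connected `T`, the open subspace
`q⁻¹((X ∖ Z)(ℂ)) = {t | pt (q t) ∉ Z}` is path connected
(`isPathConnected_preimage_setOf_pt_notMem`). For `T = X(ℂ)`: the complement of a proper
subvariety is connected; for a connected covering `T → X(ℂ)`: the restricted covering of
`(X ∖ Z)(ℂ)` is connected (`connectedSpace_preimage_setOf_pt_notMem_of_isCoveringMap`) — the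
covering form of the SURJECTIVITY `π₁((X ∖ Z)(ℂ)) ↠ π₁(X(ℂ))`, by which monodromy and
finite-index statements about `π₁` of a smooth variety are insensitive to shrinking it to a dense
Zariski open (cf. SGA 1, Exp. V Prop. 8.2 for the étale `π₁` of a normal scheme). Smoothness (at
least normality) is essential: the connected double cover of a nodal rational curve splits off
the node.

Proof. Downward induction on the codimension `c ≥ 1` of `Z`: off a Zariski-closed `Z₁ ⊆ Z` of
codimension `≥ c + 1`, `Z(ℂ)` is straightened in `X(ℂ)` by open partial homeomorphisms
`X(ℂ) ⇀ ℂ^{c'} × K`, `c' ≥ c` (`HodgeTheory.GAGADimension.exists_closed_straightening_off_of_smooth`,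
Serre GAGA §6 Cor. 3 at simple points); the charts pull back along `q` and restrict to the open
subspace `T₁ = q⁻¹((X ∖ Z₁)(ℂ))`, connected by induction, in which `q⁻¹(Z(ℂ))` is closed and
locally flat of real codimension `2c' ≥ 2`; and **a closed locally flat subset of real
codimension `≥ 2` does not separate a connected, locally path connected space**
(`isPathConnected_compl_of_locallyFlat`: Hurewicz–Wallman, Thm. IV 4, in locally flat form —
good neighbourhoods `(B ∖ 0) × B'` at flat points, path components of the complement elsewhere, a
clopen argument; the pattern of `Topology.FourManifolds.isPathConnected_compl_of_subset_iUnion_image`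
with no manifold structure). Points of codimension `> n` do not exist
(`Motives.height_add_coheight_eq_of_smoothOfRelativeDimension`), which starts the induction.
Everything is proved; no definitions, no named facts.

References: [HurewiczWallman1941] Ch. IV §5, Thm. IV 4; [SGA1] Exp. V Prop. 8.2, Exp. XII;
[SerreGAGA1956] §6 Prop. 3 Cor. 3; [Hartshorne1977] II Ex. 3.20.
-/

noncomputable section

open Set Filter Metric Topology
open CategoryTheory AlgebraicGeometry

namespace Literature.AlgebraicGeometry.FundamentalGroup

/-! ### A punctured ball is path connected in rank `> 1` -/

section PuncturedBall

variable {F : Type*} [NormedAddCommGroup F] [NormedSpace ℝ F]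

/-- In a real normed space of dimension `> 1` the punctured ball `B(0, r) ∖ {0}` is path connected:
it is the image of `S(0, 1) × (0, r)` under `(u, t) ↦ t • u`. [folklore] -/
theorem isPathConnected_ball_diff_zero (h : 1 < Module.rank ℝ F) {r : ℝ} (hr : 0 < r) :
    IsPathConnected (ball (0 : F) r \ {0}) := by
  have hs : IsPathConnected (sphere (0 : F) 1 ×ˢ Ioo (0 : ℝ) r) :=
    (isPathConnected_sphere h 0 zero_le_one).prod
      ((convex_Ioo 0 r).isPathConnected ⟨r / 2, by constructor <;> linarith⟩)
  have himage : (fun p : F × ℝ ↦ p.2 • p.1) '' (sphere (0 : F) 1 ×ˢ Ioo (0 : ℝ) r) =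
      ball 0 r \ {0} := by
    ext x
    refine ⟨?_, ?_⟩
    · rintro ⟨⟨u, t⟩, ⟨hu, ht⟩, rfl⟩
      rw [mem_sphere_zero_iff_norm] at hu
      refine ⟨?_, fun h0 ↦ ?_⟩
      · rw [mem_ball_zero_iff, norm_smul, hu, mul_one, Real.norm_of_nonneg ht.1.le]
        exact ht.2
      · rw [mem_singleton_iff, smul_eq_zero] at h0
        rcases h0 with h0 | h0
        · exact ht.1.ne' h0
        · rw [h0, norm_zero] at hu
          exact zero_ne_one hu
    · rintro ⟨hx, hx0⟩
      rw [mem_singleton_iff] at hx0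
      have hn : ‖x‖ ≠ 0 := norm_ne_zero_iff.2 hx0
      refine ⟨(‖x‖⁻¹ • x, ‖x‖), ⟨?_, ?_⟩, ?_⟩
      · rw [mem_sphere_zero_iff_norm, norm_smul, norm_inv, norm_norm, inv_mul_cancel₀ hn]
      · exact ⟨norm_pos_iff.2 hx0, mem_ball_zero_iff.1 hx⟩
      · change ‖x‖ • (‖x‖⁻¹ • x) = x
        rw [smul_smul, mul_inv_cancel₀ hn, one_smul]
  rw [← himage]
  exact hs.image (show Continuous fun p : F × ℝ ↦ p.2 • p.1 by fun_prop)

end PuncturedBall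

/-! ### Local flatness of real codimension `≥ 2` does not separate -/

section LocallyFlat

variable {M : Type*} [TopologicalSpace M]

/-- **Good neighbourhoods at a flat point of real codimension `≥ 2`.** If `S` is straightened at
`x ∈ S` by `e : M ⇀ F × K`, `dim_ℝ F ≥ 2` (`z ∈ S ↔ (e z).1 = 0` on `e.source ∋ x`), then inside any
neighbourhood of `x` there is an open `N ∋ x` with `N ∖ S ≠ ∅`, any two points of which are joined
by a path off `S` (`N` = preimage of a small product ball; `N ∖ S ↔ (B ∖ 0) × B'`).
[cite: HurewiczWallman1941, Ch. IV §5, Thm. IV 4 and Cor. 1] -/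
theorem exists_nhds_joinedIn_compl_of_flat {S : Set M} {x : M}
    {F : Type*} [NormedAddCommGroup F] [NormedSpace ℝ F] [FiniteDimensional ℝ F]
    {K : Type*} [NormedAddCommGroup K] [NormedSpace ℝ K]
    (e : OpenPartialHomeomorph M (F × K)) (hF : 2 ≤ Module.finrank ℝ F) (hxe : x ∈ e.source)
    (he : ∀ z ∈ e.source, z ∈ S ↔ (e z).1 = 0) (hx : x ∈ S) {V : Set M} (hV : V ∈ 𝓝 x) :
    ∃ N : Set M, IsOpen N ∧ x ∈ N ∧ N ⊆ V ∧ (N \ S).Nonempty ∧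
      ∀ a ∈ N \ S, ∀ b ∈ N \ S, JoinedIn Sᶜ a b := by
  have hx0 : (e x).1 = 0 := (he x hxe).1 hx
  -- a product ball inside the target, mapped into `V` by `e.symm`
  have h1 : e.target ∈ 𝓝 (e x) := e.open_target.mem_nhds (e.map_source hxe)
  have h2 : e.symm ⁻¹' V ∈ 𝓝 (e x) :=
    (e.continuousAt_symm (e.map_source hxe)).preimage_mem_nhds (by rw [e.left_inv hxe]; exact hV)
  obtain ⟨ε, hε, hball⟩ := Metric.mem_nhds_iff.1 (inter_mem h1 h2)
  set B : Set (F × K) := ball (0 : F) ε ×ˢ ball (e x).2 ε with hB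
  have hBball : B ⊆ ball (e x) ε := by
    rw [show (e x) = ((e x).1, (e x).2) from rfl, ← ball_prod_same, hx0]
  have hBt : B ⊆ e.target := fun z hz ↦ (hball (hBball hz)).1
  have hBV : ∀ z ∈ B, e.symm z ∈ V := fun z hz ↦ (hball (hBball hz)).2
  set N : Set M := e.source ∩ e ⁻¹' B with hN
  have hNo : IsOpen N := e.isOpen_inter_preimage (isOpen_ball.prod isOpen_ball)
  have hxB : e x ∈ B := ⟨by rw [hx0]; exact mem_ball_self hε, mem_ball_self hε⟩
  -- the punctured product ball
  set P : Set (F × K) := (ball (0 : F) ε \ {0}) ×ˢ ball (e x).2 ε with hP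
  have hPB : P ⊆ B := prod_mono sdiff_subset Subset.rfl
  have hPconn : IsPathConnected P :=
    (isPathConnected_ball_diff_zero
      (by exact_mod_cast Module.lt_rank_of_lt_finrank (show 1 < Module.finrank ℝ F by omega))
      hε).prod ((convex_ball _ _).isPathConnected ⟨(e x).2, mem_ball_self hε⟩)
  have hPS : e.symm '' P ⊆ Sᶜ := by
    rintro _ ⟨z, hz, rfl⟩ hzS
    have hzt : z ∈ e.target := hBt (hPB hz)
    have h0 : (e (e.symm z)).1 = 0 := (he _ (e.map_target hzt)).1 hzS
    rw [e.right_inv hzt] at h0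
    exact hz.1.2 h0
  -- points of `N ∖ S` read in the chart lie in `P`
  have hmemP : ∀ a ∈ N \ S, e a ∈ P := fun a ha ↦
    ⟨⟨ha.1.2.1, fun h0 ↦ ha.2 ((he a ha.1.1).2 h0)⟩, ha.1.2.2⟩
  refine ⟨N, hNo, ⟨hxe, hxB⟩, fun a ha ↦ ?_, ?_, fun a ha b hb ↦ ?_⟩
  · have := hBV (e a) ha.2
    rwa [e.left_inv ha.1] at this
  · obtain ⟨z, hz⟩ := hPconn.nonempty
    refine ⟨e.symm z, ⟨e.map_target (hBt (hPB hz)), ?_⟩, fun hS ↦ hPS ⟨z, hz, rfl⟩ hS⟩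
    show e (e.symm z) ∈ B
    rw [e.right_inv (hBt (hPB hz))]
    exact hPB hz
  · have hj : JoinedIn P (e a) (e b) := hPconn.joinedIn _ (hmemP a ha) _ (hmemP b hb)
    have hj' := hj.map_continuousOn (e.continuousOn_symm.mono fun z hz ↦ hBt (hPB hz))
    rw [e.left_inv ha.1.1, e.left_inv hb.1.1] at hj'
    exact hj'.mono hPS

/-- **The complement of a closed subset which is locally flat of real codimension `≥ 2` in a
connected, locally path connected space is path connected** (Hurewicz–Wallman, Thm. IV 4: closed
sets of dimension `≤ n - 2` do not separate; here in locally flat form: every `x ∈ S` has a chart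
`e : M ⇀ F × K`, `dim_ℝ F ≥ 2`, `x ∈ e.source`, `z ∈ S ↔ (e z).1 = 0` on `e.source`). Proof: good
neighbourhoods (`exists_nhds_joinedIn_compl_of_flat` on `S`, path components of `Sᶜ` elsewhere),
`S` has empty interior, and the set of points whose good neighbourhood is joined to a base point off
`S` is clopen. [cite: HurewiczWallman1941, Ch. IV §5, Thm. IV 4 and Cor. 1] -/
theorem isPathConnected_compl_of_locallyFlat [ConnectedSpace M] [LocallyPathConnectedSpace M]
    {S : Set M} (hS : IsClosed S)
    (hflat : ∀ x ∈ S, ∃ (F : Type) (_ : NormedAddCommGroup F) (_ : NormedSpace ℝ F)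
        (_ : FiniteDimensional ℝ F) (K : Type) (_ : NormedAddCommGroup K) (_ : NormedSpace ℝ K)
        (e : OpenPartialHomeomorph M (F × K)),
        2 ≤ Module.finrank ℝ F ∧ x ∈ e.source ∧ ∀ z ∈ e.source, z ∈ S ↔ (e z).1 = 0) :
    IsPathConnected Sᶜ := by
  have hnear : ∀ x ∈ S, ∀ V ∈ 𝓝 x, ∃ N : Set M, IsOpen N ∧ x ∈ N ∧ N ⊆ V ∧ (N \ S).Nonempty ∧
      ∀ a ∈ N \ S, ∀ b ∈ N \ S, JoinedIn Sᶜ a b := by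
    intro x hx V hV
    obtain ⟨F, _, _, _, K, _, _, e, hF, hxe, he⟩ := hflat x hx
    exact exists_nhds_joinedIn_compl_of_flat e hF hxe he hx hV
  -- `S` has empty interior
  have hint : interior S = ∅ := by
    by_contra hne
    obtain ⟨x, hx⟩ := nonempty_iff_ne_empty.2 hne
    obtain ⟨N, -, -, hNV, ⟨a, haN, haS⟩, -⟩ :=
      hnear x (interior_subset hx) (interior S) (isOpen_interior.mem_nhds hx)
    exact haS (interior_subset (hNV haN))
  -- good neighbourhoods about every point
  have key : ∀ x : M, ∃ N : Set M, IsOpen N ∧ x ∈ N ∧ (N \ S).Nonempty ∧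
      ∀ a ∈ N \ S, ∀ b ∈ N \ S, JoinedIn Sᶜ a b := fun x ↦ by
    by_cases hxS : x ∈ S
    · obtain ⟨N, hNo, hxN, -, hNne, hNj⟩ := hnear x hxS univ univ_mem
      exact ⟨N, hNo, hxN, hNne, hNj⟩
    · refine ⟨pathComponentIn Sᶜ x, hS.isOpen_compl.pathComponentIn x,
        mem_pathComponentIn_self hxS, ⟨x, mem_pathComponentIn_self hxS, hxS⟩,
        fun a ha b hb ↦ ?_⟩
      exact ((isPathConnected_pathComponentIn hxS).joinedIn a ha.1 b hb.1).mono
        pathComponentIn_subset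
  choose N hNo hxN hNne hNj using key
  -- overlapping neighbourhoods overlap off `S`
  have hover : ∀ x y, (N x ∩ N y).Nonempty → ((N x ∩ N y) \ S).Nonempty := fun x y hxy ↦ by
    by_contra h
    rw [not_nonempty_iff_eq_empty, sdiff_eq_empty] at h
    have : N x ∩ N y ⊆ interior S := interior_maximal h ((hNo x).inter (hNo y))
    rw [hint] at this
    exact not_nonempty_iff_eq_empty.2 (subset_empty_iff.1 this) hxy
  -- a base point and the clopen set of points joined to it
  obtain ⟨x₀⟩ := (inferInstance : Nonempty M)
  obtain ⟨a, ha⟩ := hNne x₀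
  have haS : a ∈ Sᶜ := ha.2
  refine ⟨a, haS, fun {b} hb ↦ ?_⟩
  set Q : Set M := {x | ∀ c ∈ N x \ S, JoinedIn Sᶜ a c} with hQ
  have hQopen : IsOpen Q := by
    refine isOpen_iff_forall_mem_open.2 fun x hx ↦ ⟨N x, fun x' hx' ↦ ?_, hNo x, hxN x⟩
    obtain ⟨d, ⟨hdx, hdx'⟩, hdS⟩ := hover x x' ⟨x', hx', hxN x'⟩
    intro c hc
    exact (hx d ⟨hdx, hdS⟩).trans (hNj x' d ⟨hdx', hdS⟩ c hc)
  have hQclosed : IsClosed Q := by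
    refine ⟨isOpen_iff_forall_mem_open.2 fun x hx ↦ ⟨N x, fun x' hx' hx'Q ↦ hx ?_, hNo x, hxN x⟩⟩
    obtain ⟨d, ⟨hdx, hdx'⟩, hdS⟩ := hover x x' ⟨x', hx', hxN x'⟩
    intro c hc
    exact (hx'Q d ⟨hdx', hdS⟩).trans (hNj x d ⟨hdx, hdS⟩ c hc)
  have haQ : a ∈ Q := fun c hc ↦ hNj a a ⟨hxN a, haS⟩ c hc
  have hQuniv : Q = univ := IsClopen.eq_univ ⟨hQclosed, hQopen⟩ ⟨a, haQ⟩
  have hbQ : b ∈ Q := by rw [hQuniv]; exact mem_univ b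
  exact hbQ b ⟨hxN b, hb⟩

/-- A space admitting a local homeomorphism to a locally path connected space is locally path
connected (path components of the open pieces are open). [folklore] -/
theorem locallyPathConnectedSpace_of_isLocalHomeomorph {T : Type*} [TopologicalSpace T]
    [LocallyPathConnectedSpace M] {q : T → M} (hq : IsLocalHomeomorph q) :
    LocallyPathConnectedSpace T := by
  rw [locallyPathConnectedSpace_iff_pathComponentIn_mem_nhds]
  intro t u hu htu
  obtain ⟨p, htp, -⟩ := hq t
  set p' : OpenPartialHomeomorph T M := p.restrOpen u hu with hp'
  have hsrc : p'.source = p.source ∩ u := p.restrOpen_source u hu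
  haveI : LocallyPathConnectedSpace p'.source :=
    p'.isOpenEmbedding_restrict.locallyPathConnectedSpace
  have ht' : t ∈ p'.source := by rw [hsrc]; exact ⟨htp, htu⟩
  -- the path component of `t` in the open piece, pushed into `T`
  set C : Set T := Subtype.val '' (pathComponent (⟨t, ht'⟩ : p'.source)) with hC
  have hCo : IsOpen C :=
    p'.open_source.isOpenEmbedding_subtypeVal.isOpenMap _ (IsOpen.pathComponent _)
  have htC : t ∈ C := ⟨⟨t, ht'⟩, mem_pathComponent_self _, rfl⟩
  have hCu : C ⊆ u := by
    rintro _ ⟨z, -, rfl⟩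
    exact (hsrc ▸ z.2 : (z : T) ∈ p.source ∩ u).2
  have hCsub : C ⊆ pathComponentIn u t :=
    (isPathConnected_pathComponent.image continuous_subtype_val).subset_pathComponentIn htC hCu
  exact mem_of_superset (hCo.mem_nhds htC) hCsub

end LocallyFlat

/-! ### Zariski-open complements in smooth complex varieties and their covers -/

section Algebraic

open Literature.AlgebraicGeometry.Motives Literature.AlgebraicGeometry.HodgeTheory

variable {n : ℕ} {X : SchemeOver ℂ}

/-- On an irreducible `ℂ`-scheme smooth of relative dimension `n`, a set of points of codimension
`≥ n + 1` is empty (`dim + codim = n`, the tree's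
`Motives.height_add_coheight_eq_of_smoothOfRelativeDimension`). [cite: Hartshorne1977, II Ex. 3.20 (d)] -/
theorem eq_empty_of_relativeDimension_lt_coheight [IrreducibleSpace X.left]
    [SmoothOfRelativeDimension n X.hom] {Z : Set X.left} {c : ℕ} (hc : n + 1 ≤ c)
    (hZ : ∀ z ∈ Z, (c : ℕ∞) ≤ Order.coheight z) : Z = ∅ := by
  refine Set.eq_empty_of_forall_notMem fun z hz ↦ ?_
  have h := Motives.height_add_coheight_eq_of_smoothOfRelativeDimension X.hom n z
  have h1 : (c : ℕ∞) ≤ n := (hZ z hz).trans (h ▸ le_add_self)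
  have h2 : c ≤ n := by exact_mod_cast h1
  omega

/-- **Connected covers of a smooth complex variety stay connected over a dense Zariski open.** Let `X`
be an integral `ℂ`-scheme smooth of relative dimension `n` over `ℂ`, `Z ⊆ X` Zariski-closed with
`Z ≠ X`, and `q : T → X(ℂ)` a local homeomorphism (e.g. a covering map) from a connected, locally
path connected `T`. Then `{t ∈ T | pt (q t) ∉ Z} = q⁻¹((X ∖ Z)(ℂ))` is path connected (for a
connected covering: the restricted covering of `(X ∖ Z)(ℂ)` is connected, i.e.
`π₁((X ∖ Z)(ℂ)) ↠ π₁(X(ℂ))`). Downward induction on the codimension of `Z`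
(`GAGADimension.exists_closed_straightening_off_of_smooth` + `isPathConnected_compl_of_locallyFlat`
on the open subspace over the complement of the exceptional set). [folklore] -/
theorem isPathConnected_preimage_setOf_pt_notMem [IsIntegral X.left]
    [SmoothOfRelativeDimension n X.hom] {Z : Set X.left} (hZ : IsClosed Z) (hZ' : Z ≠ Set.univ)
    {T : Type} [TopologicalSpace T] [ConnectedSpace T] [LocallyPathConnectedSpace T]
    {q : T → ComplexPoints X} (hq : IsLocalHomeomorph q) :
    IsPathConnected {t : T | (q t).pt ∉ Z} := by
  have hcZ : ∀ z ∈ Z, ((1 : ℕ) : ℕ∞) ≤ Order.coheight z := fun z hz ↦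
    HodgeTheory.one_le_coheight_of_mem_of_isClosed_of_ne_univ hZ hZ' hz
  -- downward induction on the codimension, along the straightening filtration
  suffices key : ∀ (m c : ℕ) (Z : Set X.left), n + 1 ≤ c + m → 1 ≤ c → IsClosed Z →
      (∀ z ∈ Z, (c : ℕ∞) ≤ Order.coheight z) → IsPathConnected {t : T | (q t).pt ∉ Z} from
    key (n + 1) 1 Z (by omega) le_rfl hZ hcZ
  have huniv : ∀ Z : Set X.left, Z = ∅ → IsPathConnected {t : T | (q t).pt ∉ Z} := by
    rintro Z rfl
    rw [show {t : T | (q t).pt ∉ (∅ : Set X.left)} = Set.univ from Set.eq_univ_of_forall fun t h ↦ h]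
    haveI := PathConnectedSpace.of_locallyPathConnectedSpace (X := T)
    exact isPathConnected_univ
  intro m
  induction m with
  | zero =>
    intro c Z hcm hc hZc hcZ
    exact huniv Z (eq_empty_of_relativeDimension_lt_coheight (n := n) (X := X) (by omega) hcZ)
  | succ m ih =>
    intro c Z hcm hc hZc hcZ
    by_cases hcn : n + 1 ≤ c
    · exact huniv Z (eq_empty_of_relativeDimension_lt_coheight (n := n) (X := X) hcn hcZ)
    -- the exceptional set `Z₁` and the straightening charts off it
    obtain ⟨Z₁, hZ₁, hZ₁Z, hcZ₁, hstr⟩ :=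
      GAGADimension.exists_closed_straightening_off_of_smooth (X := X) (n := n) hZc hcZ
    have ih₁ := ih (c + 1) Z₁ (by omega) (by omega) hZ₁ hcZ₁
    -- the open subspace `T₁ = q⁻¹((X ∖ Z₁)(ℂ))`, connected, and its closed subset `S = q⁻¹(Z(ℂ)) ∩ T₁`
    have hO : IsOpen {t : T | (q t).pt ∉ Z₁} :=
      (Motives.AlgPoints.isOpen_setOf_pt_mem (X := X) (L := ℂ) ⟨Z₁ᶜ, hZ₁.isOpen_compl⟩).preimage
        hq.continuous
    haveI : ConnectedSpace ↥{t : T | (q t).pt ∉ Z₁} :=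
      isConnected_iff_connectedSpace.1 ih₁.isConnected
    haveI : LocallyPathConnectedSpace ↥{t : T | (q t).pt ∉ Z₁} := hO.locallyPathConnectedSpace
    set S : Set ↥{t : T | (q t).pt ∉ Z₁} := {u | (q u.1).pt ∈ Z} with hSdef
    have hS : IsClosed S := by
      have h2 : IsClosed {P : ComplexPoints X | P.pt ∈ Z} :=
        ⟨Motives.AlgPoints.isOpen_setOf_pt_mem (X := X) (L := ℂ) ⟨Zᶜ, hZc.isOpen_compl⟩⟩
      exact (h2.preimage hq.continuous).preimage continuous_subtype_val
    -- local flatness of `S`: straighten `Z(ℂ)` at `q u`, pull back along `q`, restrict to `T₁`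
    have hflat : ∀ u ∈ S, ∃ (F : Type) (_ : NormedAddCommGroup F) (_ : NormedSpace ℝ F)
        (_ : FiniteDimensional ℝ F) (K : Type) (_ : NormedAddCommGroup K) (_ : NormedSpace ℝ K)
        (e : OpenPartialHomeomorph ↥{t : T | (q t).pt ∉ Z₁} (F × K)),
        2 ≤ Module.finrank ℝ F ∧ u ∈ e.source ∧ ∀ z ∈ e.source, z ∈ S ↔ (e z).1 = 0 := by
      intro u hu
      obtain ⟨c', K, e, hcc', hxe, he⟩ := hstr (q u.1) hu u.2
      obtain ⟨p, hup, hpq⟩ := hq u.1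
      have hpq' : ∀ t, p t = q t := fun t ↦ by rw [hpq]
      let s : TopologicalSpace.Opens T := ⟨{t : T | (q t).pt ∉ Z₁}, hO⟩
      let e₁ : OpenPartialHomeomorph T ((Fin c' → ℂ) × ↥K) := p.trans e
      let e' : OpenPartialHomeomorph ↥{t : T | (q t).pt ∉ Z₁} ((Fin c' → ℂ) × ↥K) :=
        e₁.subtypeRestr (s := s) ⟨u⟩
      refine ⟨Fin c' → ℂ, inferInstance, inferInstance, inferInstance, ↥K, inferInstance,
        inferInstance, e', ?_, ?_, fun z hz ↦ ?_⟩
      · have hfr : Module.finrank ℝ (Fin c' → ℂ) = 2 * c' := by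
          rw [Module.finrank_pi_fintype, Finset.sum_const, Finset.card_univ, Fintype.card_fin,
            Complex.finrank_real_complex, smul_eq_mul, mul_comm]
        rw [hfr]
        omega
      · rw [OpenPartialHomeomorph.subtypeRestr_source]
        show u.1 ∈ e₁.source
        rw [OpenPartialHomeomorph.trans_source]
        exact ⟨hup, by rw [Set.mem_preimage, hpq']; exact hxe⟩
      · rw [OpenPartialHomeomorph.subtypeRestr_source] at hz
        have hz' : (z : T) ∈ e₁.source := hz
        rw [OpenPartialHomeomorph.trans_source] at hz'
        have hqz : q z.1 ∈ e.source := by rw [← hpq']; exact hz'.2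
        change (q z.1).pt ∈ Z ↔ (e (p z.1)).1 = 0
        rw [hpq']
        exact he (q z.1) hqz
    have hconn := isPathConnected_compl_of_locallyFlat hS hflat
    -- the image of `Sᶜ ⊆ T₁` in `T` is `q⁻¹((X ∖ Z)(ℂ))`, as `Z₁ ⊆ Z`
    have himage : Subtype.val '' Sᶜ = {t : T | (q t).pt ∉ Z} := by
      refine Set.Subset.antisymm ?_ fun t ht ↦ ⟨⟨t, fun h1 ↦ ht (hZ₁Z h1)⟩, ht, rfl⟩
      rintro _ ⟨u, hu, rfl⟩
      exact hu
    rw [← himage]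
    exact hconn.image continuous_subtype_val

/-- **The complement of a proper Zariski-closed subset in the complex points of a smooth complex
variety is path connected** (`q = id`; cf. `ComplexPoints.isConnected_setOf_pt_mem_inter_of_isIrreducible`
for connectedness without smoothness). [folklore] -/
theorem isPathConnected_setOf_pt_notMem [IsIntegral X.left] [SmoothOfRelativeDimension n X.hom]
    {Z : Set X.left} (hZ : IsClosed Z) (hZ' : Z ≠ Set.univ)
    [ConnectedSpace (ComplexPoints X)] [LocallyPathConnectedSpace (ComplexPoints X)] :
    IsPathConnected {P : ComplexPoints X | P.pt ∉ Z} :=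
  isPathConnected_preimage_setOf_pt_notMem (n := n) hZ hZ'
    (Homeomorph.refl (ComplexPoints X)).isLocalHomeomorph

/-- **A connected covering of `X(ℂ)` restricts to a connected covering of `(X ∖ Z)(ℂ)`** (`X` an
integral `ℂ`-scheme smooth of relative dimension `n`, `Z ⊊ X` Zariski-closed): the covering form of
the surjectivity `π₁((X ∖ Z)(ℂ)) ↠ π₁(X(ℂ))`. [folklore] -/
theorem connectedSpace_preimage_setOf_pt_notMem_of_isCoveringMap [IsIntegral X.left]
    [SmoothOfRelativeDimension n X.hom] {Z : Set X.left} (hZ : IsClosed Z) (hZ' : Z ≠ Set.univ)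
    {T : Type} [TopologicalSpace T] [ConnectedSpace T] {q : T → ComplexPoints X}
    (hq : IsCoveringMap q) [LocallyPathConnectedSpace (ComplexPoints X)] :
    ConnectedSpace ↥(q ⁻¹' {P : ComplexPoints X | P.pt ∉ Z}) := by
  haveI : LocallyPathConnectedSpace T :=
    locallyPathConnectedSpace_of_isLocalHomeomorph hq.isLocalHomeomorph
  exact isConnected_iff_connectedSpace.1
    (isPathConnected_preimage_setOf_pt_notMem (n := n) hZ hZ' hq.isLocalHomeomorph).isConnected

end Algebraic

end Literature.AlgebraicGeometry.FundamentalGroup
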